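import Summits.KontsevichZagierPeriods.KontsevichZagierPeriods.Theorems.RootDecompWalshStrataPolarChart03

/-!
# The elliptic-polar chart, part 4/5: sector bookkeeping moves; conics under affine maps

Declarations `AffMap.swap` … `Conic.affPre_inv_pxy` of the farm-checked gen-7 file `PolarChart.lean`: the swap, the two
reflections and the dilations as `AffMap`s, the elliptic weight `ellW κ₀ κ₁ γ a c = γ√(a(κ₀X² + κ₁Y²) + c)` and its
transport under them (`InBaker.of_swap`, `of_negX`, `of_negY`, `of_dil`, `to_dil`), the Lagrange step
`InBaker.of_lagrange : [lagM S, γ√(d₁₁X² + μY² + c)] ∈ InBaker → [S, γ√D_K] ∈ InBaker`, and conics precomposed with affine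
maps (`Conic.affPre`, `affPre_pxy`, `affPre_inv_pxy`: the walls of a transported atom are again rational conics).
See the module docstring of `RootDecompWalshStrataPolarChart01` (part 1). [KontsevichZagier2001 §1.2 rule (2); this node gen 7]
-/

noncomputable section

open Set MeasureTheory MvPolynomial Literature.NumberTheory.Transcendental
open Literature.ModelTheory.ExponentialFields (IsSemialgebraic isSemialgebraic_univ)

namespace Summit.KontsevichZagierPeriods.RootDecompWalshStrata.ConicDescent.BallCube

variable {κ₀ κ₁ : ℚ}

/-! #### 32.9 Sector bookkeeping: the named affine moves and how the weight `γ√(a(κ₀X² + κ₁Y²) + c)` transforms; conics under affine maps -/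

namespace AffMap

/-- The swap `(X, Y) ↦ (Y, X)` (det `−1`). -/
def swap : AffMap := ⟨0, 1, 1, 0, 0, 0⟩
/-- The reflection `X ↦ −X` (det `−1`). -/
def negX : AffMap := ⟨-1, 0, 0, 1, 0, 0⟩
/-- The reflection `Y ↦ −Y` (det `−1`). -/
def negY : AffMap := ⟨1, 0, 0, -1, 0, 0⟩
/-- The dilation by `λ` (det `λ²`). -/
def dil (l : ℚ) : AffMap := ⟨l, 0, 0, l, 0, 0⟩

/-- Auxiliary step `swap_toFun_zero`. [bookkeeping] -/
@[simp] theorem swap_toFun_zero (p : Fin 2 → ℝ) : swap.toFun p 0 = p 1 := by simp [swap, toFun]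
/-- Auxiliary step `swap_toFun_one`. [bookkeeping] -/
@[simp] theorem swap_toFun_one (p : Fin 2 → ℝ) : swap.toFun p 1 = p 0 := by simp [swap, toFun]
/-- Auxiliary step `negX_toFun_zero`. [bookkeeping] -/
@[simp] theorem negX_toFun_zero (p : Fin 2 → ℝ) : negX.toFun p 0 = -p 0 := by simp [negX, toFun]
/-- Auxiliary step `negX_toFun_one`. [bookkeeping] -/
@[simp] theorem negX_toFun_one (p : Fin 2 → ℝ) : negX.toFun p 1 = p 1 := by simp [negX, toFun]
/-- Auxiliary step `negY_toFun_zero`. [bookkeeping] -/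
@[simp] theorem negY_toFun_zero (p : Fin 2 → ℝ) : negY.toFun p 0 = p 0 := by simp [negY, toFun]
/-- Auxiliary step `negY_toFun_one`. [bookkeeping] -/
@[simp] theorem negY_toFun_one (p : Fin 2 → ℝ) : negY.toFun p 1 = -p 1 := by simp [negY, toFun]
/-- Auxiliary step `dil_toFun_zero`. [bookkeeping] -/
@[simp] theorem dil_toFun_zero (l : ℚ) (p : Fin 2 → ℝ) : (dil l).toFun p 0 = l * p 0 := by
  simp [dil, toFun]
/-- Auxiliary step `dil_toFun_one`. [bookkeeping] -/
@[simp] theorem dil_toFun_one (l : ℚ) (p : Fin 2 → ℝ) : (dil l).toFun p 1 = l * p 1 := by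
  simp [dil, toFun]
/-- Auxiliary step `swap_det`. [bookkeeping] -/
@[simp] theorem swap_det : swap.det = -1 := by simp [swap, det]
/-- Auxiliary step `negX_det`. [bookkeeping] -/
@[simp] theorem negX_det : negX.det = -1 := by simp [negX, det]
/-- Auxiliary step `negY_det`. [bookkeeping] -/
@[simp] theorem negY_det : negY.det = -1 := by simp [negY, det]
/-- Auxiliary step `dil_det`. [bookkeeping] -/
@[simp] theorem dil_det (l : ℚ) : (dil l).det = l ^ 2 := by simp [dil, det]; ring

end AffMap

/-- The elliptic weight `γ√(a(κ₀X² + κ₁Y²) + c)`. [this node] -/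
def ellW (κ₀ κ₁ γ a c : ℚ) (w : Fin 2 → ℝ) : ℝ :=
  (γ : ℝ) * √(a * (κ₀ * w 0 ^ 2 + κ₁ * w 1 ^ 2) + c)

/-- Auxiliary step `ellW_swap`. [bookkeeping] -/
theorem ellW_swap (κ₀ κ₁ γ a c : ℚ) (p : Fin 2 → ℝ) :
    ellW κ₁ κ₀ γ a c (AffMap.swap.toFun p) = ellW κ₀ κ₁ γ a c p := by
  simp only [ellW, AffMap.swap_toFun_zero, AffMap.swap_toFun_one]
  ring_nf

/-- Auxiliary step `ellW_negX`. [bookkeeping] -/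
theorem ellW_negX (κ₀ κ₁ γ a c : ℚ) (p : Fin 2 → ℝ) :
    ellW κ₀ κ₁ γ a c (AffMap.negX.toFun p) = ellW κ₀ κ₁ γ a c p := by
  simp only [ellW, AffMap.negX_toFun_zero, AffMap.negX_toFun_one, neg_sq]

/-- Auxiliary step `ellW_negY`. [bookkeeping] -/
theorem ellW_negY (κ₀ κ₁ γ a c : ℚ) (p : Fin 2 → ℝ) :
    ellW κ₀ κ₁ γ a c (AffMap.negY.toFun p) = ellW κ₀ κ₁ γ a c p := by
  simp only [ellW, AffMap.negY_toFun_zero, AffMap.negY_toFun_one, neg_sq]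

/-- Under the dilation by `λ ≠ 0` the weight with `a` pulls back, Jacobian included, to the weight with
`aλ²` and `γλ²`. [this node] -/
theorem ellW_dil (κ₀ κ₁ γ a c l : ℚ) (p : Fin 2 → ℝ) :
    ellW κ₀ κ₁ γ a c ((AffMap.dil l).toFun p) * |((AffMap.dil l).det : ℝ)| =
      ellW κ₀ κ₁ (γ * l ^ 2) (a * l ^ 2) c p := by
  simp only [ellW, AffMap.dil_toFun_zero, AffMap.dil_toFun_one, AffMap.dil_det]
  push_cast
  rw [abs_of_nonneg (sq_nonneg (l : ℝ))]
  ring_nf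

/-- SWAP: `[S, γ√(a(κ₀X² + κ₁Y²) + c)]` from `[swap S, γ√(a(κ₁X² + κ₀Y²) + c)]`. [this node] -/
theorem InBaker.of_swap (κ₀ κ₁ γ a c : ℚ) (ρ σ : KZ.IntegralRep 2)
    (hσ : σ.domain = AffMap.swap.toFun '' ρ.domain)
    (hρi : ∀ p ∈ ρ.domain, ρ.integrand p = ellW κ₀ κ₁ γ a c p)
    (hσi : ∀ w ∈ σ.domain, σ.integrand w = ellW κ₁ κ₀ γ a c w) (h : InBaker (KZ.of σ)) :
    InBaker (KZ.of ρ) :=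
  AffMap.swap.inBaker_to (by simp) ρ σ hσ (fun p hp => by
    rw [hρi p hp, hσi _ (hσ ▸ mem_image_of_mem _ hp), ellW_swap, AffMap.swap_det]
    simp) h

/-- REFLECTION `X ↦ −X`. [this node] -/
theorem InBaker.of_negX (κ₀ κ₁ γ a c : ℚ) (ρ σ : KZ.IntegralRep 2)
    (hσ : σ.domain = AffMap.negX.toFun '' ρ.domain)
    (hρi : ∀ p ∈ ρ.domain, ρ.integrand p = ellW κ₀ κ₁ γ a c p)
    (hσi : ∀ w ∈ σ.domain, σ.integrand w = ellW κ₀ κ₁ γ a c w) (h : InBaker (KZ.of σ)) :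
    InBaker (KZ.of ρ) :=
  AffMap.negX.inBaker_to (by simp) ρ σ hσ (fun p hp => by
    rw [hρi p hp, hσi _ (hσ ▸ mem_image_of_mem _ hp), ellW_negX, AffMap.negX_det]
    simp) h

/-- REFLECTION `Y ↦ −Y`. [this node] -/
theorem InBaker.of_negY (κ₀ κ₁ γ a c : ℚ) (ρ σ : KZ.IntegralRep 2)
    (hσ : σ.domain = AffMap.negY.toFun '' ρ.domain)
    (hρi : ∀ p ∈ ρ.domain, ρ.integrand p = ellW κ₀ κ₁ γ a c p)
    (hσi : ∀ w ∈ σ.domain, σ.integrand w = ellW κ₀ κ₁ γ a c w) (h : InBaker (KZ.of σ)) :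
    InBaker (KZ.of ρ) :=
  AffMap.negY.inBaker_to (by simp) ρ σ hσ (fun p hp => by
    rw [hρi p hp, hσi _ (hσ ▸ mem_image_of_mem _ hp), ellW_negY, AffMap.negY_det]
    simp) h

/-- DILATION by a rational `λ ≠ 0` (to bring a bounded target inside `κ₀X² + κ₁Y² < 1`):
`[S, γλ²√(aλ²(κ₀X² + κ₁Y²) + c)]` ↔ `[λS, γ√(a(κ₀X² + κ₁Y²) + c)]`. [this node] -/
theorem InBaker.of_dil (κ₀ κ₁ γ a c l : ℚ) (hl : l ≠ 0) (ρ σ : KZ.IntegralRep 2)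
    (hσ : σ.domain = (AffMap.dil l).toFun '' ρ.domain)
    (hρi : ∀ p ∈ ρ.domain, ρ.integrand p = ellW κ₀ κ₁ (γ * l ^ 2) (a * l ^ 2) c p)
    (hσi : ∀ w ∈ σ.domain, σ.integrand w = ellW κ₀ κ₁ γ a c w) (h : InBaker (KZ.of σ)) :
    InBaker (KZ.of ρ) :=
  (AffMap.dil l).inBaker_to (by simpa using pow_ne_zero 2 hl) ρ σ hσ (fun p hp => by
    rw [hρi p hp, hσi _ (hσ ▸ mem_image_of_mem _ hp), ellW_dil]) h

/-- The same four moves in the other direction (from the source to the image). [this node] -/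
theorem InBaker.to_dil (κ₀ κ₁ γ a c l : ℚ) (hl : l ≠ 0) (ρ σ : KZ.IntegralRep 2)
    (hσ : σ.domain = (AffMap.dil l).toFun '' ρ.domain)
    (hρi : ∀ p ∈ ρ.domain, ρ.integrand p = ellW κ₀ κ₁ (γ * l ^ 2) (a * l ^ 2) c p)
    (hσi : ∀ w ∈ σ.domain, σ.integrand w = ellW κ₀ κ₁ γ a c w) (h : InBaker (KZ.of ρ)) :
    InBaker (KZ.of σ) :=
  (AffMap.dil l).inBaker_of (by simpa using pow_ne_zero 2 hl) ρ σ hσ (fun p hp => by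
    rw [hρi p hp, hσi _ (hσ ▸ mem_image_of_mem _ hp), ellW_dil]) h

/-- The Lagrange step: `[S, γ√D_K]` for positive-definite quadratic part ⟸ `[lagM S, γ√(κ₀X² + κ₁Y² + c)]`
with `κ₀ = d₁₁`, `κ₁ = μ`, `c = cst` (det 1). [Lagrange; this node] -/
theorem InBaker.of_lagrange (K : Quadric₃) (h11 : 0 < K.dq.d11) (hdisc : 0 < K.dq.disc) (γ : ℚ)
    (ρ σ : KZ.IntegralRep 2) (hσ : σ.domain = K.dq.lagM.toFun '' ρ.domain)
    (hρi : ∀ p ∈ ρ.domain, ρ.integrand p = (γ : ℝ) * √(K.Dxy (p 0) (p 1)))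
    (hσi : ∀ w ∈ σ.domain, σ.integrand w = ellW K.dq.d11 K.dq.μ γ 1 K.dq.cst w)
    (h : InBaker (KZ.of σ)) : InBaker (KZ.of ρ) :=
  K.dq.lagM.inBaker_to (by rw [Quad2.lagM_det]; exact one_ne_zero) ρ σ hσ (fun p hp => by
    rw [hρi p hp, hσi _ (hσ ▸ mem_image_of_mem _ hp), ellW, Quad2.lagM_det, K.Dxy_posdef h11 hdisc]
    have hp01 : (![p 0, p 1] : Fin 2 → ℝ) = p := by
      funext j; fin_cases j <;> rfl
    rw [hp01]
    push_cast
    ring_nf) h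

/-- A conic precomposed with a rational affine map: `(F.affPre N)(p) = F(N p)` (so the zero set of
`F.affPre M.inv` is the image under `M` of the zero set of `F`). [this node] -/
def _root_.Summit.KontsevichZagierPeriods.RootDecompWalshStrata.ConicDescent.Conic.affPre (F : Conic) (N : AffMap) : Conic :=
  ⟨F.A * N.m11 ^ 2 + F.b1 * N.m01 * N.m11 + F.c2 * N.m01 ^ 2,
    2 * F.A * N.m11 * N.c1 + F.b0 * N.m11 + F.b1 * (N.m01 * N.c1 + N.c0 * N.m11) + F.c1 * N.m01 +
      2 * F.c2 * N.c0 * N.m01,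
    2 * F.A * N.m10 * N.m11 + F.b1 * (N.m00 * N.m11 + N.m01 * N.m10) + 2 * F.c2 * N.m00 * N.m01,
    F.A * N.c1 ^ 2 + F.b0 * N.c1 + F.b1 * N.c0 * N.c1 + F.c0 + F.c1 * N.c0 + F.c2 * N.c0 ^ 2,
    2 * F.A * N.m10 * N.c1 + F.b0 * N.m10 + F.b1 * (N.m00 * N.c1 + N.c0 * N.m10) + F.c1 * N.m00 +
      2 * F.c2 * N.c0 * N.m00,
    F.A * N.m10 ^ 2 + F.b1 * N.m00 * N.m10 + F.c2 * N.m00 ^ 2⟩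

/-- Auxiliary step `affPre_pxy`. [bookkeeping] -/
theorem _root_.Summit.KontsevichZagierPeriods.RootDecompWalshStrata.ConicDescent.Conic.affPre_pxy (F : Conic) (N : AffMap)
    (p : Fin 2 → ℝ) : (F.affPre N).pxy (p 0) (p 1) = F.pxy (N.toFun p 0) (N.toFun p 1) := by
  simp only [Conic.affPre, Conic.pxy, Conic.Bx, Conic.Cx, AffMap.toFun_zero, AffMap.toFun_one]
  push_cast
  ring

/-- Zero sets and signs of a conic transported by an invertible affine map. [this node] -/
theorem _root_.Summit.KontsevichZagierPeriods.RootDecompWalshStrata.ConicDescent.Conic.affPre_inv_pxy (F : Conic) (M : AffMap)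
    (hdet : M.det ≠ 0) (p : Fin 2 → ℝ) :
    (F.affPre M.inv).pxy (M.toFun p 0) (M.toFun p 1) = F.pxy (p 0) (p 1) := by
  rw [Conic.affPre_pxy, M.inv_toFun hdet]

end Summit.KontsevichZagierPeriods.RootDecompWalshStrata.ConicDescent.BallCube
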